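import Mathlib.Analysis.SpecialFunctions.Pow.Real
import Mathlib.Analysis.SpecialFunctions.Trigonometric.Basic
import Mathlib.Analysis.Calculus.Deriv.Mul
import Mathlib.MeasureTheory.Integral.Lebesgue.Add
import Mathlib.MeasureTheory.Constructions.BorelSpace.Basic
import Mathlib.MeasureTheory.Measure.Lebesgue.Basic
import HarnessLib

/-!
# Elgindi's weighted spaces `𝓗ᵏ` on the quarter strip: the operators `D_z`, `D_θ`, the weights
`w`, `w_θ`, `W` and the `𝓗ᵏ` norm

Topic `Literature/Analysis/FluidPDE`. Second file (definitions with their algebraic API, everything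
proved, no named facts) of the self-similar framework of T. M. Elgindi, Ann. of Math. 194 (2021)
(arXiv:1904.04795, `[Elgindi2021]`) and Elgindi–Ghoul–Masmoudi, Camb. J. Math. 9 (2021)
(arXiv:1910.14071, `[ElgindiGhoulMasmoudi2021]`), on the decomposition path of the named fact
`Literature.Analysis.FluidPDE.ElgindiGhoulMasmoudi2021_blowupSolution` (companion of
`ElgindiFundamentalModel.lean`: `K`, `Γ`, `c`, `L₁₂`, `F_*`). The stability theorem
([ElgindiGhoulMasmoudi2021] §2.5 Thm 2) and Elgindi's profile `F = F_* + α²g`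
(`|g|_{𝓗ᵏ} ≤ C`) are stated in the norms defined here ("p." = chunk of the held texts).

## The printed definitions ([ElgindiGhoulMasmoudi2021] §1.7, p. 5–6; [Elgindi2021] §1.7.1–1.7.2, p. 7)

Functions live on `(z, θ) ∈ [0, ∞) × [0, π/2]` (`z` = `R`, `y` or `z` in the sources, the
radial self-similar variable; `θ = arctan(x₃/r)`), with "the usual `L²` norm with the measure
`dr dθ` and not the measure `r dr dθ`" (ibid., Warning). Parameters: `η = 99/100`,
`γ = 1 + α/10`. Weights: `w(z) = (1+z)²/z²`, `w_θ(θ) = sin(2θ)^{−γ/2}`, `W = w · w_θ`. Operators: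
`D_θ f = sin(2θ) ∂_θ f`, `D_R f = R ∂_R f` (`= D_z`, `D_y`). The `𝓗ᵏ` norm
([ElgindiGhoulMasmoudi2021] §1.7, the display defining `𝓗ᵏ([0,∞) × [0,π/2])`, p. 6;
[Elgindi2021] §1.7.2):
`|f|²_{𝓗ᵏ} = ∑_{i=0}^k |D_R^i f · w / sin^{η/2}(2θ)|²_{L²} + ∑_{i ≥ 1, 1 ≤ i+j ≤ k} |D_θ^i D_R^j f · W|²_{L²}`
(Elgindi writes the mixed term as `D_R^j D_θ^i f`; the two operators act on different variables
and commute on smooth functions).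

## Rendering

* `Elgindi.Dz`, `Elgindi.Dθ` act on curried functions `f : ℝ → ℝ → ℝ`, `f z θ`, through
  Mathlib's one-variable `deriv` in the respective variable (junk value `0` where the partial
  derivative does not exist; the norm is meant for functions smooth on the open strip).
* `Elgindi.strip = Set.Ioi 0 ×ˢ Set.Ioo 0 (π/2)` is the open quarter strip; `Elgindi.eL2Sq g = ∫⁻_strip ‖g‖ₑ²`
  is the squared `L²(dz dθ)` norm as a `[0, ∞]`-valued functional (no junk), and
  `Elgindi.eHkNormSq α k f ∈ [0, ∞]` is `|f|²_{𝓗ᵏ}` with `η = 99/100`, `γ = 1 + α/10` substituted;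
  membership in `𝓗ᵏ` is finiteness of this functional (plus the smoothness the user requires).
* The weights are real functions; at the endpoints `θ = 0, π/2` the power `sin(2θ)^{−γ/2}` takes
  Mathlib's junk value `0^{−γ/2} = 0`, invisible to the integrals over the open strip.

## What is proved (API)

Linearity of `D_z`, `D_θ` and their iterates in the function (`Dz_smul`, `iterate_Dz_smul`, …),
`D(0) = 0`, the scaling `eL2Sq (c • g) = ‖c‖ₑ² eL2Sq g`, hence
**`|c f|²_{𝓗ᵏ} = |c|² |f|²_{𝓗ᵏ}`** (`eHkNormSq_smul`), `|0|_{𝓗ᵏ} = 0`, and **monotonicity in `k`**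
(`eHkNormSq_mono`). Not here: the embedding `𝓗ᵏ ↪ L^∞` ([ElgindiGhoulMasmoudi2021] Lemma 9.1,
[Elgindi2021] Cor. 8.4), Hardy's inequality for `L₁₂` ([Elgindi2021] Lemma 5.4), the product
rules — analytic content for later files; nor the spaces `𝓦^{l,∞}` (whose definitions differ
between the two papers).

Mathlib/tree search (`lean search 'Elgindi|weighted Sobolev|HkNorm' --decl`): no weighted spaces
of this kind in Mathlib or the tree. Used from Mathlib: `deriv`, `deriv_const_mul_field`,
`Function.iterate`, `lintegral_const_mul'`, `Finset.sum_le_sum_of_subset`.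
-/

noncomputable section

open MeasureTheory Set Real Finset
open scoped ENNReal

namespace Literature.Analysis.FluidPDE

namespace Elgindi

/-! ### The scaling derivatives `D_z`, `D_θ` -/

/-- The radial scaling derivative `D_z f = z ∂_z f` (also written `D_R = R∂_R`, `D_y = y∂_y`)
(Elgindi 2021, §1.7.2; Elgindi–Ghoul–Masmoudi 2021, §1.7), on curried functions `f z θ` of the
quarter strip, through Mathlib's `deriv` in the first variable. [cite: ElgindiGhoulMasmoudi2021, §1.7 (p. 6 of arXiv:1910.14071): D_R(f) = R∂_R f] -/
def Dz (f : ℝ → ℝ → ℝ) (z θ : ℝ) : ℝ :=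
  z * deriv (fun z' => f z' θ) z

/-- The angular derivative `D_θ f = sin(2θ) ∂_θ f` (Elgindi 2021, §1.7.2; Elgindi–Ghoul–Masmoudi
2021, §1.7), through Mathlib's `deriv` in the second variable. [cite: ElgindiGhoulMasmoudi2021, §1.7 (p. 6): D_θ(f) = sin(2θ)∂_θ f] -/
def Dθ (f : ℝ → ℝ → ℝ) (z θ : ℝ) : ℝ :=
  Real.sin (2 * θ) * deriv (fun θ' => f z θ') θ

/-- Unfolding `D_z`. [folklore] -/
theorem Dz_apply (f : ℝ → ℝ → ℝ) (z θ : ℝ) : Dz f z θ = z * deriv (fun z' => f z' θ) z := rfl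

/-- Unfolding `D_θ`. [folklore] -/
theorem Dθ_apply (f : ℝ → ℝ → ℝ) (z θ : ℝ) :
    Dθ f z θ = Real.sin (2 * θ) * deriv (fun θ' => f z θ') θ := rfl

/-- `D_z` is homogeneous: `D_z (c f) = c D_z f` (no differentiability needed over a field). [folklore] -/
theorem Dz_smul (c : ℝ) (f : ℝ → ℝ → ℝ) : Dz (c • f) = c • Dz f := by
  funext z θ
  simp only [Dz, Pi.smul_apply, smul_eq_mul, deriv_const_mul_field]
  ring

/-- `D_θ` is homogeneous: `D_θ (c f) = c D_θ f`. [folklore] -/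
theorem Dθ_smul (c : ℝ) (f : ℝ → ℝ → ℝ) : Dθ (c • f) = c • Dθ f := by
  funext z θ
  simp only [Dθ, Pi.smul_apply, smul_eq_mul, deriv_const_mul_field]
  ring

/-- Iterates of `D_z` are homogeneous. [folklore] -/
theorem iterate_Dz_smul (n : ℕ) (c : ℝ) (f : ℝ → ℝ → ℝ) : Dz^[n] (c • f) = c • Dz^[n] f := by
  induction n with
  | zero => rfl
  | succ n ih => rw [Function.iterate_succ_apply', Function.iterate_succ_apply', ih, Dz_smul]

/-- Iterates of `D_θ` are homogeneous. [folklore] -/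
theorem iterate_Dθ_smul (n : ℕ) (c : ℝ) (f : ℝ → ℝ → ℝ) : Dθ^[n] (c • f) = c • Dθ^[n] f := by
  induction n with
  | zero => rfl
  | succ n ih => rw [Function.iterate_succ_apply', Function.iterate_succ_apply', ih, Dθ_smul]

/-- `D_z 0 = 0`. [folklore] -/
@[simp] theorem Dz_zero : Dz 0 = 0 := by
  funext z θ
  simp [Dz]

/-- `D_θ 0 = 0`. [folklore] -/
@[simp] theorem Dθ_zero : Dθ 0 = 0 := by
  funext z θ
  simp [Dθ]

/-- Iterates of `D_z` kill `0`. [folklore] -/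
@[simp] theorem iterate_Dz_zero (n : ℕ) : Dz^[n] 0 = 0 := by
  induction n with
  | zero => rfl
  | succ n ih => rw [Function.iterate_succ_apply', ih, Dz_zero]

/-- Iterates of `D_θ` kill `0`. [folklore] -/
@[simp] theorem iterate_Dθ_zero (n : ℕ) : Dθ^[n] 0 = 0 := by
  induction n with
  | zero => rfl
  | succ n ih => rw [Function.iterate_succ_apply', ih, Dθ_zero]

/-! ### Parameters and weights -/

/-- The parameter `η = 99/100` (Elgindi 2021, §1.7.1; Elgindi–Ghoul–Masmoudi 2021, §1.7). [cite: ElgindiGhoulMasmoudi2021, §1.7 (p. 5): η = 99/100] -/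
def eta : ℝ := 99 / 100

/-- The parameter `γ = 1 + α/10` (Elgindi 2021, §1.7.1; Elgindi–Ghoul–Masmoudi 2021, §1.7). [cite: ElgindiGhoulMasmoudi2021, §1.7 (p. 5): γ = 1 + α/10] -/
def gammaExp (α : ℝ) : ℝ := 1 + α / 10

/-- The radial weight `w(z) = (1+z)²/z²` (Elgindi 2021, §1.7.2; Elgindi–Ghoul–Masmoudi 2021,
§1.7). Junk value at `z = 0` (division by zero), invisible to integrals over `z > 0`. [cite: ElgindiGhoulMasmoudi2021, §1.7 (p. 6): w(z) = (1+z)²/z²] -/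
def radialWeight (z : ℝ) : ℝ := (1 + z) ^ 2 / z ^ 2

/-- The angular weight `w_θ(θ) = sin(2θ)^{−γ/2}`, `γ = 1 + α/10` (Elgindi 2021, §1.7.2;
Elgindi–Ghoul–Masmoudi 2021, §1.7). At `θ ∈ {0, π/2}` Mathlib's `0 ^ (−γ/2) = 0` is a junk value. [cite: ElgindiGhoulMasmoudi2021, §1.7 (p. 6): w_θ = sin(2θ)^{−γ/2}] -/
def thetaWeight (α θ : ℝ) : ℝ := Real.sin (2 * θ) ^ (-(gammaExp α / 2))

/-- The total weight `W = w · w_θ` (Elgindi 2021, §1.7.2; Elgindi–Ghoul–Masmoudi 2021, §1.7). [cite: ElgindiGhoulMasmoudi2021, §1.7 (p. 6): W = w · w_θ] -/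
def totalWeight (α z θ : ℝ) : ℝ := radialWeight z * thetaWeight α θ

/-- The `𝓗⁰` weight `w(z)/sin^{η/2}(2θ)` of the purely radial terms of the `𝓗ᵏ` norm
(Elgindi 2021, §1.7.2, the norm `|f|_𝓗 = |f w / sin(2θ)^{η/2}|_{L²}`). [cite: Elgindi2021, §1.7.2 (p. 7): |f|_𝓗 = |f w sin(2θ)^{−η/2}|_{L²}] -/
def hWeight (z θ : ℝ) : ℝ := radialWeight z / Real.sin (2 * θ) ^ (eta / 2)

/-- `η = 99/100 ∈ (0, 1)`. [folklore] -/
theorem eta_pos : 0 < eta := by norm_num [eta]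

/-- `γ > 1` for `α > 0` (so that `sin(2θ)^{2−γ}`-type weights stay integrable). [folklore] -/
theorem one_lt_gammaExp {α : ℝ} (hα : 0 < α) : 1 < gammaExp α := by
  unfold gammaExp
  linarith

/-- `w > 0` for `z > 0`. [folklore] -/
theorem radialWeight_pos {z : ℝ} (hz : 0 < z) : 0 < radialWeight z := by
  unfold radialWeight
  positivity

/-- `w_θ > 0` inside the quarter `0 < θ < π/2`. [folklore] -/
theorem thetaWeight_pos (α : ℝ) {θ : ℝ} (hθ : θ ∈ Set.Ioo 0 (π / 2)) : 0 < thetaWeight α θ := by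
  have h2 : 0 < Real.sin (2 * θ) :=
    Real.sin_pos_of_pos_of_lt_pi (by linarith [hθ.1]) (by linarith [hθ.2])
  exact Real.rpow_pos_of_pos h2 _

/-! ### The quarter strip and the `L²(dz dθ)` functional -/

/-- The open quarter strip `{(z, θ) : z > 0, 0 < θ < π/2}` (Elgindi–Ghoul–Masmoudi 2021, §1.7:
functions on `[0, ∞) × [0, π/2]`; the boundary is a null set for `dz dθ`). [cite: ElgindiGhoulMasmoudi2021, §1.7 (p. 5–6)] -/
def strip : Set (ℝ × ℝ) := Set.Ioi 0 ×ˢ Set.Ioo 0 (π / 2)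

/-- The strip is measurable. [folklore] -/
theorem measurableSet_strip : MeasurableSet strip :=
  measurableSet_Ioi.prod measurableSet_Ioo

/-- The squared `L²(dz dθ)` norm on the strip, `∫∫_strip |g(z,θ)|² dz dθ ∈ [0, ∞]`
(Elgindi–Ghoul–Masmoudi 2021, §1.7, Warning: "the usual `L²` norm with the measure `dr dθ` and
not the measure `r dr dθ`"). Lower Lebesgue integral: no junk value. [cite: ElgindiGhoulMasmoudi2021, §1.7 (p. 6), Warning on the measure dr dθ] -/
def eL2Sq (g : ℝ → ℝ → ℝ) : ℝ≥0∞ :=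
  ∫⁻ p in strip, ‖g p.1 p.2‖ₑ ^ 2

/-- `‖0‖²_{L²} = 0`. [folklore] -/
@[simp] theorem eL2Sq_zero : eL2Sq 0 = 0 := by
  simp [eL2Sq]

/-- Scaling: `‖c g‖²_{L²} = |c|² ‖g‖²_{L²}`. [folklore] -/
theorem eL2Sq_smul (c : ℝ) (g : ℝ → ℝ → ℝ) : eL2Sq (c • g) = ‖c‖ₑ ^ 2 * eL2Sq g := by
  unfold eL2Sq
  rw [← lintegral_const_mul' _ _ (by simp)]
  congr 1
  funext p
  simp only [Pi.smul_apply, smul_eq_mul, enorm_mul, mul_pow]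

/-! ### The `𝓗ᵏ` norm -/

/-- The radial term of order `j` of the `𝓗ᵏ` norm: `D_z^j f · w / sin^{η/2}(2θ)`. [cite: ElgindiGhoulMasmoudi2021, §1.7 (p. 6), first sum of the 𝓗ᵏ norm] -/
def hkRadialTerm (j : ℕ) (f : ℝ → ℝ → ℝ) : ℝ → ℝ → ℝ :=
  fun z θ => Dz^[j] f z θ * hWeight z θ

/-- The mixed term of orders `(i, j)` of the `𝓗ᵏ` norm: `D_θ^i D_z^j f · W`. [cite: ElgindiGhoulMasmoudi2021, §1.7 (p. 6), second sum of the 𝓗ᵏ norm] -/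
def hkMixedTerm (α : ℝ) (i j : ℕ) (f : ℝ → ℝ → ℝ) : ℝ → ℝ → ℝ :=
  fun z θ => Dθ^[i] (Dz^[j] f) z θ * totalWeight α z θ

/-- **The squared `𝓗ᵏ` norm** `|f|²_{𝓗ᵏ} = ∑_{j=0}^k ‖D_z^j f · w / sin^{η/2}(2θ)‖²_{L²}
 + ∑_{i ≥ 1, 1 ≤ i+j ≤ k} ‖D_θ^i D_z^j f · W‖²_{L²}` on the quarter strip with the measure `dz dθ`,
`η = 99/100`, `γ = 1 + α/10` (Elgindi–Ghoul–Masmoudi 2021, §1.7, display defining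
`𝓗ᵏ([0,∞) × [0,π/2])`; Elgindi 2021, §1.7.2), as a `[0, ∞]`-valued functional: membership in `𝓗ᵏ`
is finiteness. The double sum runs over `i, j ≤ k` with the printed constraint as an `if`. [cite: ElgindiGhoulMasmoudi2021, §1.7 (p. 6 of arXiv:1910.14071): the 𝓗ᵏ norm]
[cite: Elgindi2021, §1.7.2 (p. 7 of arXiv:1904.04795)] -/
def eHkNormSq (α : ℝ) (k : ℕ) (f : ℝ → ℝ → ℝ) : ℝ≥0∞ :=
  (∑ j ∈ range (k + 1), eL2Sq (hkRadialTerm j f)) +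
    ∑ i ∈ range (k + 1), ∑ j ∈ range (k + 1),
      if 1 ≤ i ∧ i + j ≤ k then eL2Sq (hkMixedTerm α i j f) else 0

/-- The `𝓗ᵏ` norm `|f|_{𝓗ᵏ} = (|f|²_{𝓗ᵏ})^{1/2} ∈ [0, ∞]`. [cite: ElgindiGhoulMasmoudi2021, §1.7 (p. 6): the 𝓗ᵏ norm] -/
def eHkNorm (α : ℝ) (k : ℕ) (f : ℝ → ℝ → ℝ) : ℝ≥0∞ :=
  eHkNormSq α k f ^ (1 / 2 : ℝ)

/-- The radial terms are homogeneous in `f`. [folklore] -/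
theorem hkRadialTerm_smul (j : ℕ) (c : ℝ) (f : ℝ → ℝ → ℝ) :
    hkRadialTerm j (c • f) = c • hkRadialTerm j f := by
  funext z θ
  simp only [hkRadialTerm, iterate_Dz_smul, Pi.smul_apply, smul_eq_mul]
  ring

/-- The mixed terms are homogeneous in `f`. [folklore] -/
theorem hkMixedTerm_smul (α : ℝ) (i j : ℕ) (c : ℝ) (f : ℝ → ℝ → ℝ) :
    hkMixedTerm α i j (c • f) = c • hkMixedTerm α i j f := by
  funext z θ
  simp only [hkMixedTerm, iterate_Dz_smul, iterate_Dθ_smul, Pi.smul_apply, smul_eq_mul]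
  ring

/-- The radial terms of `0` vanish. [folklore] -/
@[simp] theorem hkRadialTerm_zero (j : ℕ) : hkRadialTerm j 0 = 0 := by
  funext z θ
  simp [hkRadialTerm]

/-- The mixed terms of `0` vanish. [folklore] -/
@[simp] theorem hkMixedTerm_zero (α : ℝ) (i j : ℕ) : hkMixedTerm α i j 0 = 0 := by
  funext z θ
  simp [hkMixedTerm]

/-- `|0|²_{𝓗ᵏ} = 0`. [folklore] -/
@[simp] theorem eHkNormSq_zero (α : ℝ) (k : ℕ) : eHkNormSq α k 0 = 0 := by
  simp [eHkNormSq]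

/-- **Homogeneity**: `|c f|²_{𝓗ᵏ} = |c|² |f|²_{𝓗ᵏ}`. [folklore] -/
theorem eHkNormSq_smul (α : ℝ) (k : ℕ) (c : ℝ) (f : ℝ → ℝ → ℝ) :
    eHkNormSq α k (c • f) = ‖c‖ₑ ^ 2 * eHkNormSq α k f := by
  simp only [eHkNormSq, hkRadialTerm_smul, hkMixedTerm_smul, eL2Sq_smul, mul_add, mul_sum]
  congr 1
  refine sum_congr rfl fun i _ => sum_congr rfl fun j _ => ?_
  split_ifs <;> simp

/-- **Monotonicity in `k`**: `|f|²_{𝓗ᵏ} ≤ |f|²_{𝓗ᵏ'}` for `k ≤ k'` (more terms, same terms). [folklore] -/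
theorem eHkNormSq_mono (α : ℝ) {k k' : ℕ} (hk : k ≤ k') (f : ℝ → ℝ → ℝ) :
    eHkNormSq α k f ≤ eHkNormSq α k' f := by
  have hsub : range (k + 1) ⊆ range (k' + 1) := range_subset_range.2 (by omega)
  unfold eHkNormSq
  refine add_le_add (sum_le_sum_of_subset hsub) ?_
  refine (sum_le_sum_of_subset hsub).trans (sum_le_sum fun i _ => ?_)
  refine (sum_le_sum_of_subset hsub).trans (sum_le_sum fun j _ => ?_)
  by_cases h : 1 ≤ i ∧ i + j ≤ k
  · rw [if_pos h, if_pos ⟨h.1, h.2.trans hk⟩]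
  · rw [if_neg h]
    exact zero_le

/-- `𝓗⁰` is the weighted `L²` space `𝓗` of Elgindi 2021, §1.7.2: `|f|²_{𝓗⁰} = ‖f w/sin^{η/2}(2θ)‖²_{L²}`
(no mixed terms). [cite: Elgindi2021, §1.7.2 (p. 7): |f|_𝓗 = |f w sin(2θ)^{−η/2}|_{L²}] -/
theorem eHkNormSq_zero_order (α : ℝ) (f : ℝ → ℝ → ℝ) :
    eHkNormSq α 0 f = eL2Sq (hkRadialTerm 0 f) := by
  simp [eHkNormSq]

end Elgindi

end Literature.Analysis.FluidPDE
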